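import Mathlib
import HarnessLib

/-!
# Route `PoloidalWindowDoor`, item `LrcModEntire` (stmt-NavierStokesRegularity-20428), cell (Q4-sonic, straight branch, μ(−1,0) < 0), case I —
# CAUCHY–KOVALEVSKAYA UNIQUENESS FOR A SYSTEM ACROSS A FLAT SHEET: the normal-jet recursion in `Y × ℝ` (any tangential space `Y`), brick B-CK2

Cell ns-regularity-ideate, LEAD-lineage seat ns-poloidal-K2-p3 g17 (`--supports stmt-NavierStokesRegularity-20428`; memo `Cruxes/LrcModEntire/T2B-g17.md` v2 §5(5a)(5g)).
Class-free.  Generalises the scalar, three-variable `…SheetCauchyUniqueness.eq_zero_on_slab` (p726202) to what §5 needs: SEVERAL unknowns, a FOURTH (time)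
variable, and coefficients depending on all variables.  We work in a product `Y × ℝ` — `Y` a real normed space of TANGENTIAL variables (in §5: `(t, s, z)`),
the second factor the NORMAL variable `m` (in §5: `m = n − d(t,z)`, the signed offset from the moving web sheet) — on the tube `O × ℝ` over an open set `O ⊆ Y`;
the sheet is `{m = 0}`.

* «`F` vanishes to order `k` on the sheet» — `∂_m^j F (y, 0) = 0` for all `j ≤ k`, `y ∈ O` (spelled out in every statement as
  `∀ j ≤ k, ∀ y ∈ O, ((pd dN)^[j] F) (y, 0) = 0`: the normal jet of `F` vanishes to order `k` on the sheet).
* TOOLKIT: the class is stable under tangential derivatives (`vanishesToOrder_pd_tangential`), loses one order under `∂_m` (`vanishesToOrder_pdN`), is stable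
  under sums and under multiplication by ANY smooth coefficient (`vanishesToOrder_mul` — by induction with the first-order product rule, no binomial Leibniz), and
  respects equality on the tube (`vanishesToOrder_congr`).
* `vanishesToOrder_all_of_system` — **the Cauchy–Kovalevskaya recursion for a system**: if for every `k`, vanishing of `ψ` and `g` to order `k+1` forces vanishing
  of `∂_m²ψ` and `∂_m²g` to order `k` (this is what a pair of equations `∂_m²ψ = R_ψ`, `∂_m²g = R_g` with right sides in the toolkit's span gives — the
  hypersurface `{m = 0}` being NON-characteristic exactly means the equations can be solved for `∂_m²`), and `ψ, ∂_mψ, g, ∂_mg` vanish on the sheet, then the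
  whole normal jets of `ψ` and `g` vanish on the sheet.
* `eq_zero_on_tube_of_vanishesToOrder` — if moreover `F` is real-analytic along every normal line, `F ≡ 0` on the tube; `system_eq_zero_on_tube` packages both.

Use (T2B-g17 §5): `(ψ, g) = (∂_eφ, ∂_eθ)` (or the finite-difference pair for `U(·+Le) − U`) in the sheared coordinates of the space–time web sheet of case I; the
two equations are (E2) `Δₕψ + ∂_z g = 0` and (E3) = `∂_e` of the (TH) vertical equation, both solvable for `∂_m²` because the sheet's conormal has a horizontal
component; the four Cauchy data vanish iff the web-frame strain row `(S_{ee}, S_{eν})` vanishes on the sheet.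

WHAT THIS IS NOT: not a claim about Navier–Stokes regularity and not a stub of the registry; class-free calculus for the residual research cell `stub_Q4sonicLineNeg`
of `Cruxes/LrcModEntire/Lines/twist_split.lean` v12 (bears_on LADDER-NS N0 via item 20428).
-/

noncomputable section

set_option linter.dupNamespace false

namespace Summit.NavierStokesRegularity.NavierStokesRegularity.Theorems.PoloidalWindowDoorLrcModEntireSheetSystemUniqueness

open Set Function Filter Topology
open scoped ContDiff

variable {Y : Type*} [NormedAddCommGroup Y] [NormedSpace ℝ Y]

/-! ### Setting: the tube `O × ℝ`, directional derivatives, the normal direction -/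

/-- Directional partial derivative operator `∂_v F (p) = DF(p)[v]` on `Y × ℝ`. -/
def pd (v : Y × ℝ) (F : Y × ℝ → ℝ) : Y × ℝ → ℝ := fun p => fderiv ℝ F p v

/-- The normal direction `∂_m` (the sheet is `{m = 0}`, `m` the second coordinate). -/
def dN : Y × ℝ := (0, 1)

/-- A tangential direction `(w, 0)`. -/
def tg (w : Y) : Y × ℝ := (w, 0)

/-- The open tube `O × ℝ` over a set `O` of tangential points. -/
def tube (O : Set Y) : Set (Y × ℝ) := {p | p.1 ∈ O}

omit [NormedSpace ℝ Y] in
/-- The tube over an open set is open. -/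
theorem isOpen_tube {O : Set Y} (hO : IsOpen O) : IsOpen (tube O) := hO.preimage continuous_fst

omit [NormedAddCommGroup Y] [NormedSpace ℝ Y] in
/-- Points of the tube. -/
theorem mem_tube {O : Set Y} {y : Y} (hy : y ∈ O) (m : ℝ) : ((y, m) : Y × ℝ) ∈ tube O := hy

/-- A smooth function on the open tube has smooth partial derivatives there. -/
theorem contDiffOn_pd {O : Set Y} (hO : IsOpen O) {F : Y × ℝ → ℝ} (hF : ContDiffOn ℝ ∞ F (tube O)) (v : Y × ℝ) :
    ContDiffOn ℝ ∞ (pd v F) (tube O) := by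
  have h1 : ContDiffOn ℝ ∞ (fderiv ℝ F) (tube O) := hF.fderiv_of_isOpen (isOpen_tube hO) (m := ∞) (by simp)
  exact h1.clm_apply contDiffOn_const

/-- Iterated partial derivatives stay smooth on the tube. -/
theorem contDiffOn_iterate_pd {O : Set Y} (hO : IsOpen O) {F : Y × ℝ → ℝ} (hF : ContDiffOn ℝ ∞ F (tube O)) (v : Y × ℝ) (j : ℕ) :
    ContDiffOn ℝ ∞ ((pd v)^[j] F) (tube O) := by
  induction j with
  | zero => simpa using hF
  | succ j ih =>
    rw [Function.iterate_succ', Function.comp_def]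
    exact contDiffOn_pd hO ih v

/-- A smooth function on the tube is differentiable at its points. -/
theorem differentiableAt_of_tube {O : Set Y} (hO : IsOpen O) {F : Y × ℝ → ℝ} (hF : ContDiffOn ℝ ∞ F (tube O)) {p : Y × ℝ}
    (hp : p ∈ tube O) : DifferentiableAt ℝ F p :=
  (hF.contDiffAt ((isOpen_tube hO).mem_nhds hp)).differentiableAt (by simp)

/-- At a point of the tube, `∂_v(∂_w F) = D²F[v][w]`. -/
theorem pd_pd_eq_fderiv_fderiv {O : Set Y} (hO : IsOpen O) {F : Y × ℝ → ℝ} (hF : ContDiffOn ℝ ∞ F (tube O))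
    (v w : Y × ℝ) {p : Y × ℝ} (hp : p ∈ tube O) : pd v (pd w F) p = fderiv ℝ (fderiv ℝ F) p v w := by
  have hFp : ContDiffAt ℝ ∞ F p := hF.contDiffAt ((isOpen_tube hO).mem_nhds hp)
  have hD : DifferentiableAt ℝ (fderiv ℝ F) p := (hFp.fderiv_right (m := 1) (by norm_cast)).differentiableAt (by norm_num)
  unfold pd
  rw [fderiv_clm_apply hD (differentiableAt_const w)]
  simp

/-- **Partial derivatives of a smooth function commute** on the open tube. -/
theorem pd_comm {O : Set Y} (hO : IsOpen O) {F : Y × ℝ → ℝ} (hF : ContDiffOn ℝ ∞ F (tube O)) (v w : Y × ℝ) {p : Y × ℝ}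
    (hp : p ∈ tube O) : pd v (pd w F) p = pd w (pd v F) p := by
  rw [pd_pd_eq_fderiv_fderiv hO hF v w hp, pd_pd_eq_fderiv_fderiv hO hF w v hp]
  have hFp : ContDiffAt ℝ ∞ F p := hF.contDiffAt ((isOpen_tube hO).mem_nhds hp)
  exact hFp.isSymmSndFDerivAt (by simp only [minSmoothness_of_isRCLikeNormedField]; norm_cast) v w

/-- `pd` respects equality on the open tube. -/
theorem pd_congr_on_tube {O : Set Y} (hO : IsOpen O) {F G : Y × ℝ → ℝ} (v : Y × ℝ) (h : ∀ p ∈ tube O, F p = G p) {p : Y × ℝ}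
    (hp : p ∈ tube O) : pd v F p = pd v G p := by
  unfold pd
  rw [(Filter.eventuallyEq_of_mem ((isOpen_tube hO).mem_nhds hp) h).fderiv_eq]

/-- Iterated `pd` respects equality on the open tube. -/
theorem iterate_pd_congr_on_tube {O : Set Y} (hO : IsOpen O) {F G : Y × ℝ → ℝ} (v : Y × ℝ) (h : ∀ p ∈ tube O, F p = G p) :
    ∀ (j : ℕ), ∀ p ∈ tube O, ((pd v)^[j] F) p = ((pd v)^[j] G) p := by
  intro j
  induction j with
  | zero => simpa using h
  | succ j ih =>
    intro p hp
    rw [Function.iterate_succ', Function.comp_def]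
    exact pd_congr_on_tube hO v ih hp

/-- `pd` is additive on smooth functions (pointwise on the tube). -/
theorem pd_add {O : Set Y} (hO : IsOpen O) {F G : Y × ℝ → ℝ} (hF : ContDiffOn ℝ ∞ F (tube O)) (hG : ContDiffOn ℝ ∞ G (tube O))
    (v : Y × ℝ) {p : Y × ℝ} (hp : p ∈ tube O) : pd v (fun q => F q + G q) p = pd v F p + pd v G p := by
  unfold pd
  rw [fderiv_fun_add (differentiableAt_of_tube hO hF hp) (differentiableAt_of_tube hO hG hp)]
  rfl

/-- The product rule for `pd` (pointwise on the tube). -/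
theorem pd_mul {O : Set Y} (hO : IsOpen O) {a F : Y × ℝ → ℝ} (ha : ContDiffOn ℝ ∞ a (tube O)) (hF : ContDiffOn ℝ ∞ F (tube O))
    (v : Y × ℝ) {p : Y × ℝ} (hp : p ∈ tube O) : pd v (fun q => a q * F q) p = pd v a p * F p + a p * pd v F p := by
  unfold pd
  rw [fderiv_fun_mul (differentiableAt_of_tube hO ha hp) (differentiableAt_of_tube hO hF hp)]
  simp only [_root_.add_apply, _root_.smul_apply, smul_eq_mul]
  ring

/-- **A function vanishing on the sheet has vanishing TANGENTIAL derivatives there**: if `K(y, 0) = 0` for all `y ∈ O` (`O` open) then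
`∂_{(w,0)}K(y,0) = 0`. -/
theorem pd_tangential_eq_zero_of_vanish_on_sheet {O : Set Y} (hO : IsOpen O) {K : Y × ℝ → ℝ} (hK : ∀ y ∈ O, K (y, 0) = 0)
    {y : Y} (hy : y ∈ O) (hd : DifferentiableAt ℝ K (y, 0)) (w : Y) : pd (tg w) K (y, 0) = 0 := by
  unfold pd
  have hline : HasDerivAt (fun r : ℝ => K ((y, 0) + r • tg w)) (fderiv ℝ K (y, 0) (tg w)) 0 := by
    have h1 : HasFDerivAt K (fderiv ℝ K (y, 0)) ((y, 0) + (0 : ℝ) • tg w) := by simpa using hd.hasFDerivAt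
    have h2 : HasDerivAt (fun r : ℝ => ((y, 0) : Y × ℝ) + r • tg w) (tg w) 0 := by
      simpa using ((hasDerivAt_id (0 : ℝ)).smul_const (tg w)).const_add ((y, 0) : Y × ℝ)
    exact h1.comp_hasDerivAt 0 h2
  have hzero : (fun r : ℝ => K ((y, 0) + r • tg w)) =ᶠ[𝓝 0] fun _ => 0 := by
    have hIo : ∀ᶠ r : ℝ in 𝓝 0, y + r • w ∈ O := by
      have hcont : Continuous fun r : ℝ => y + r • w := by fun_prop
      have h0 : y + (0 : ℝ) • w ∈ O := by simpa using hy
      exact hcont.continuousAt.preimage_mem_nhds (hO.mem_nhds h0)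
    filter_upwards [hIo] with r hr
    have : ((y, 0) : Y × ℝ) + r • tg w = (y + r • w, 0) := by ext <;> simp [tg]
    rw [this]
    exact hK _ hr
  have h0 : HasDerivAt (fun r : ℝ => K ((y, 0) + r • tg w)) 0 0 := by
    have := (hasDerivAt_const (0 : ℝ) (0 : ℝ)).congr_of_eventuallyEq hzero
    simpa using this
  exact hline.unique h0

/-! ### Vanishing to a given order on the sheet -/

/-! Throughout, «`F` VANISHES TO ORDER `k` on the sheet over `O`» is the displayed predicate
`∀ j ≤ k, ∀ y ∈ O, ((pd dN)^[j] F) (y, 0) = 0` (the normal jet of `F` vanishes to order `k`); it is spelled out in every statement. -/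

/-- Vanishing to order `k` implies vanishing to every lower order. -/
theorem vanishesToOrder_mono {O : Set Y} {F : Y × ℝ → ℝ} {k l : ℕ} (h : ∀ j ≤ k, ∀ y ∈ O, ((pd dN)^[j] F) (y, 0) = 0) (hl : l ≤ k) :
    ∀ j ≤ l, ∀ y ∈ O, ((pd dN)^[j] F) (y, 0) = 0 := fun j hj y hy => h j (hj.trans hl) y hy

/-- Vanishing to order `k` implies vanishing of the values on the sheet. -/
theorem zero_val_of_vanishesToOrder {O : Set Y} {F : Y × ℝ → ℝ} {k : ℕ} (h : ∀ j ≤ k, ∀ y ∈ O, ((pd dN)^[j] F) (y, 0) = 0) {y : Y}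
    (hy : y ∈ O) : F (y, 0) = 0 := by
  simpa using h 0 (Nat.zero_le _) y hy

/-- Vanishing to order `k` respects equality on the tube. -/
theorem vanishesToOrder_congr {O : Set Y} (hO : IsOpen O) {F G : Y × ℝ → ℝ} (h : ∀ p ∈ tube O, F p = G p) {k : ℕ}
    (hF : (∀ j ≤ k, ∀ y ∈ O, ((pd dN)^[j] F) (y, 0) = 0)) : (∀ j ≤ k, ∀ y ∈ O, ((pd dN)^[j] G) (y, 0) = 0) := by
  intro j hj y hy
  rw [← iterate_pd_congr_on_tube hO dN h j (y, 0) (mem_tube hy 0)]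
  exact hF j hj y hy

/-- One order is lost under the normal derivative: `F` to order `k+1` ⇒ `∂_mF` to order `k`. -/
theorem vanishesToOrder_pdN {O : Set Y} {F : Y × ℝ → ℝ} {k : ℕ} (h : (∀ j ≤ (k + 1), ∀ y ∈ O, ((pd dN)^[j] F) (y, 0) = 0)) :
    (∀ j ≤ k, ∀ y ∈ O, ((pd dN)^[j] (pd dN F)) (y, 0) = 0) := by
  intro j hj y hy
  have := h (j + 1) (by omega) y hy
  rwa [Function.iterate_succ, Function.comp_def] at this

/-- Conversely: `F(·,0) = 0` and `∂_mF` to order `k` ⇒ `F` to order `k+1`. -/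
theorem vanishesToOrder_succ_of_pdN {O : Set Y} {F : Y × ℝ → ℝ} {k : ℕ} (h0 : ∀ y ∈ O, F (y, 0) = 0)
    (h : (∀ j ≤ k, ∀ y ∈ O, ((pd dN)^[j] (pd dN F)) (y, 0) = 0)) : (∀ j ≤ (k + 1), ∀ y ∈ O, ((pd dN)^[j] F) (y, 0) = 0) := by
  intro j hj y hy
  rcases j with _ | j
  · simpa using h0 y hy
  · have := h j (by omega) y hy
    rwa [Function.iterate_succ, Function.comp_def]

/-- Iterated normal derivatives commute with a tangential derivative on the tube. -/
theorem iterate_pdN_pd_tangential {O : Set Y} (hO : IsOpen O) {F : Y × ℝ → ℝ} (hF : ContDiffOn ℝ ∞ F (tube O)) (w : Y) :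
    ∀ (j : ℕ), ∀ p ∈ tube O, ((pd dN)^[j] (pd (tg w) F)) p = pd (tg w) ((pd dN)^[j] F) p := by
  intro j
  induction j with
  | zero => intro p hp; simp
  | succ j ih =>
    intro p hp
    have hj : ContDiffOn ℝ ∞ ((pd dN)^[j] F) (tube O) := contDiffOn_iterate_pd hO hF dN j
    simp only [Function.iterate_succ', Function.comp_apply]
    rw [pd_congr_on_tube hO dN ih hp]
    exact pd_comm hO hj dN (tg w) hp

/-- **Stability under tangential derivatives**: `F` to order `k` ⇒ `∂_{(w,0)}F` to order `k`. -/
theorem vanishesToOrder_pd_tangential {O : Set Y} (hO : IsOpen O) {F : Y × ℝ → ℝ} (hF : ContDiffOn ℝ ∞ F (tube O)) {k : ℕ}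
    (h : (∀ j ≤ k, ∀ y ∈ O, ((pd dN)^[j] F) (y, 0) = 0)) (w : Y) : (∀ j ≤ k, ∀ y ∈ O, ((pd dN)^[j] (pd (tg w) F)) (y, 0) = 0) := by
  intro j hj y hy
  rw [iterate_pdN_pd_tangential hO hF w j (y, 0) (mem_tube hy 0)]
  have hj' : ContDiffOn ℝ ∞ ((pd dN)^[j] F) (tube O) := contDiffOn_iterate_pd hO hF dN j
  exact pd_tangential_eq_zero_of_vanish_on_sheet hO (fun y' hy' => h j hj y' hy') hy
    (differentiableAt_of_tube hO hj' (mem_tube hy 0)) w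

/-- **Stability under sums.** -/
theorem vanishesToOrder_add {O : Set Y} (hO : IsOpen O) {F G : Y × ℝ → ℝ} (hF : ContDiffOn ℝ ∞ F (tube O)) (hG : ContDiffOn ℝ ∞ G (tube O))
    {k : ℕ} (hFk : (∀ j ≤ k, ∀ y ∈ O, ((pd dN)^[j] F) (y, 0) = 0)) (hGk : (∀ j ≤ k, ∀ y ∈ O, ((pd dN)^[j] G) (y, 0) = 0)) : (∀ j ≤ k, ∀ y ∈ O, ((pd dN)^[j] (fun q => F q + G q)) (y, 0) = 0) := by
  -- iterated normal derivatives are additive on the tube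
  have hadd : ∀ (j : ℕ), ∀ p ∈ tube O, ((pd dN)^[j] (fun q => F q + G q)) p = ((pd dN)^[j] F) p + ((pd dN)^[j] G) p := by
    intro j
    induction j with
    | zero => intro p hp; simp
    | succ j ih =>
      intro p hp
      simp only [Function.iterate_succ', Function.comp_apply]
      rw [pd_congr_on_tube hO dN ih hp]
      exact pd_add hO (contDiffOn_iterate_pd hO hF dN j) (contDiffOn_iterate_pd hO hG dN j) dN hp
  intro j hj y hy
  rw [hadd j (y, 0) (mem_tube hy 0), hFk j hj y hy, hGk j hj y hy, add_zero]

/-- **Stability under multiplication by a smooth coefficient** (induction with the first-order product rule; no binomial Leibniz formula needed). -/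
theorem vanishesToOrder_mul {O : Set Y} (hO : IsOpen O) :
    ∀ (k : ℕ) {a F : Y × ℝ → ℝ}, ContDiffOn ℝ ∞ a (tube O) → ContDiffOn ℝ ∞ F (tube O) →
      (∀ j ≤ k, ∀ y ∈ O, ((pd dN)^[j] F) (y, 0) = 0) → (∀ j ≤ k, ∀ y ∈ O, ((pd dN)^[j] (fun q => a q * F q)) (y, 0) = 0) := by
  intro k
  induction k with
  | zero =>
    intro a F ha hF h j hj y hy
    have hj0 : j = 0 := Nat.le_zero.1 hj
    subst hj0
    simp [zero_val_of_vanishesToOrder h hy]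
  | succ k ih =>
    intro a F ha hF h
    have h0 : ∀ y ∈ O, (fun q => a q * F q) (y, 0) = 0 := fun y hy => by simp [zero_val_of_vanishesToOrder h hy]
    refine vanishesToOrder_succ_of_pdN h0 ?_
    -- `∂_m(aF) = (∂_m a)F + a(∂_m F)` on the tube, and both products vanish to order `k`
    have hprod : ∀ p ∈ tube O, (fun q => pd dN a q * F q + a q * pd dN F q) p = pd dN (fun q => a q * F q) p :=
      fun p hp => (pd_mul hO ha hF dN hp).symm
    refine vanishesToOrder_congr hO hprod ?_
    have ha' := contDiffOn_pd hO ha dN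
    have hF' := contDiffOn_pd hO hF dN
    exact vanishesToOrder_add hO (ha'.mul hF) (ha.mul hF') (ih ha' hF (vanishesToOrder_mono h (Nat.le_succ k))) (ih ha hF' (vanishesToOrder_pdN h))

/-! ### The Cauchy–Kovalevskaya recursion for a system of two unknowns -/

/-- **CK RECURSION FOR A 2×2 SYSTEM.**  If the sheet `{m = 0}` is non-characteristic in the sense that vanishing of `ψ, g` to order `k+1` forces vanishing of
`∂_m²ψ, ∂_m²g` to order `k` (every `k`), and the Cauchy data `ψ, ∂_mψ, g, ∂_mg` vanish on the sheet, then the whole normal jets vanish. -/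
theorem vanishesToOrder_all_of_system {O : Set Y} {ψ g : Y × ℝ → ℝ}
    (hstep : ∀ k : ℕ, (∀ j ≤ (k + 1), ∀ y ∈ O, ((pd dN)^[j] ψ) (y, 0) = 0) → (∀ j ≤ (k + 1), ∀ y ∈ O, ((pd dN)^[j] g) (y, 0) = 0) →
      (∀ j ≤ k, ∀ y ∈ O, ((pd dN)^[j] (pd dN (pd dN ψ))) (y, 0) = 0) ∧ (∀ j ≤ k, ∀ y ∈ O, ((pd dN)^[j] (pd dN (pd dN g))) (y, 0) = 0))
    (hψ0 : ∀ y ∈ O, ψ (y, 0) = 0) (hψ1 : ∀ y ∈ O, pd dN ψ (y, 0) = 0)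
    (hg0 : ∀ y ∈ O, g (y, 0) = 0) (hg1 : ∀ y ∈ O, pd dN g (y, 0) = 0) :
    ∀ k : ℕ, (∀ j ≤ k, ∀ y ∈ O, ((pd dN)^[j] ψ) (y, 0) = 0) ∧ (∀ j ≤ k, ∀ y ∈ O, ((pd dN)^[j] g) (y, 0) = 0) := by
  -- order one from the data
  have base : (∀ j ≤ 1, ∀ y ∈ O, ((pd dN)^[j] ψ) (y, 0) = 0) ∧ (∀ j ≤ 1, ∀ y ∈ O, ((pd dN)^[j] g) (y, 0) = 0) := by
    constructor
    · refine vanishesToOrder_succ_of_pdN hψ0 ?_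
      intro j hj y hy
      have hj0 : j = 0 := Nat.le_zero.1 hj
      subst hj0; simpa using hψ1 y hy
    · refine vanishesToOrder_succ_of_pdN hg0 ?_
      intro j hj y hy
      have hj0 : j = 0 := Nat.le_zero.1 hj
      subst hj0; simpa using hg1 y hy
  -- induction: order `k+1` ⇒ order `k+2`
  have key : ∀ k : ℕ, (∀ j ≤ (k + 1), ∀ y ∈ O, ((pd dN)^[j] ψ) (y, 0) = 0) ∧ (∀ j ≤ (k + 1), ∀ y ∈ O, ((pd dN)^[j] g) (y, 0) = 0) := by
    intro k
    induction k with
    | zero => exact base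
    | succ k ih =>
      obtain ⟨hψ, hg⟩ := ih
      obtain ⟨hψ2, hg2⟩ := hstep k hψ hg
      constructor
      · exact vanishesToOrder_succ_of_pdN hψ0 (vanishesToOrder_succ_of_pdN hψ1 hψ2)
      · exact vanishesToOrder_succ_of_pdN hg0 (vanishesToOrder_succ_of_pdN hg1 hg2)
  intro k
  exact ⟨vanishesToOrder_mono (key k).1 (Nat.le_succ k), vanishesToOrder_mono (key k).2 (Nat.le_succ k)⟩

/-! ### The analytic conclusion -/

/-- The derivative of a normal line of `K` is the value of `∂_mK`. -/
theorem deriv_line_eq_pd {O : Set Y} (hO : IsOpen O) {K : Y × ℝ → ℝ} (hK : ContDiffOn ℝ ∞ K (tube O)) {y : Y} (hy : y ∈ O) (m : ℝ) :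
    deriv (fun r : ℝ => K (y, r)) m = pd dN K (y, m) := by
  have hd : HasFDerivAt K (fderiv ℝ K (y, m)) ((fun r : ℝ => ((y, r) : Y × ℝ)) m) :=
    (differentiableAt_of_tube hO hK (mem_tube hy m)).hasFDerivAt
  have hl : HasDerivAt (fun r : ℝ => ((y, r) : Y × ℝ)) dN m := by
    have h : HasDerivAt (fun r : ℝ => ((y, r) : Y × ℝ)) ((0 : Y), (1 : ℝ)) m :=
      (hasDerivAt_const m y).prodMk (hasDerivAt_id m)
    simpa [dN] using h
  have h : HasDerivAt (fun r : ℝ => K (y, r)) (fderiv ℝ K (y, m) dN) m := hd.comp_hasDerivAt m hl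
  rw [h.deriv]
  rfl

/-- The iterated derivatives of a normal line are the values of the iterated normal derivatives. -/
theorem iteratedDeriv_line_eq {O : Set Y} (hO : IsOpen O) {F : Y × ℝ → ℝ} (hF : ContDiffOn ℝ ∞ F (tube O)) {y : Y} (hy : y ∈ O) :
    ∀ (j : ℕ) (m : ℝ), iteratedDeriv j (fun r : ℝ => F (y, r)) m = ((pd dN)^[j] F) (y, m) := by
  intro j
  induction j with
  | zero => intro m; simp
  | succ j ih =>
    intro m
    rw [iteratedDeriv_succ, Function.iterate_succ', Function.comp_def]
    have e : iteratedDeriv j (fun r : ℝ => F (y, r)) = fun r => ((pd dN)^[j] F) (y, r) := funext ih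
    rw [e]
    exact deriv_line_eq_pd hO (contDiffOn_iterate_pd hO hF dN j) hy m

/-- **A function whose whole normal jet vanishes on the sheet and which is real-analytic along normal lines vanishes on the tube.** -/
theorem eq_zero_on_tube_of_vanishesToOrder {O : Set Y} (hO : IsOpen O) {F : Y × ℝ → ℝ} (hF : ContDiffOn ℝ ∞ F (tube O))
    (han : ∀ y ∈ O, AnalyticOnNhd ℝ (fun r : ℝ => F (y, r)) univ) (hall : ∀ k : ℕ, (∀ j ≤ k, ∀ y ∈ O, ((pd dN)^[j] F) (y, 0) = 0))
    {y : Y} (hy : y ∈ O) (m : ℝ) : F (y, m) = 0 := by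
  set φ : ℝ → ℝ := fun r => F (y, r) with hφ
  have hφan : AnalyticOnNhd ℝ φ univ := han y hy
  have hφ0 : AnalyticAt ℝ φ 0 := hφan 0 (mem_univ _)
  have hcoef : ∀ j : ℕ, iteratedDeriv j φ 0 = 0 := fun j => by
    rw [hφ, iteratedDeriv_line_eq hO hF hy j 0]
    exact hall j j le_rfl y hy
  have htop : analyticOrderAt φ 0 = ⊤ := by
    rw [ENat.eq_top_iff_forall_ge]
    intro n
    rw [natCast_le_analyticOrderAt_iff_iteratedDeriv_eq_zero hφ0]
    exact fun i _ => hcoef i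
  have hev : ∀ᶠ r in 𝓝 (0 : ℝ), φ r = 0 := analyticOrderAt_eq_top.1 htop
  have hzero := hφan.eqOn_zero_of_preconnected_of_eventuallyEq_zero isPreconnected_univ (mem_univ (0 : ℝ)) hev
  exact hzero (mem_univ m)

/-- **CAUCHY–KOVALEVSKAYA UNIQUENESS FOR A 2×2 SYSTEM ACROSS THE FLAT SHEET `{m = 0}`.**  `ψ, g` smooth on the tube `O × ℝ` (`O` open), real-analytic along
every normal line, with the non-characteristic recursion property `hstep` and zero Cauchy data on the sheet ⊢ `ψ ≡ 0` and `g ≡ 0` on the tube. -/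
theorem system_eq_zero_on_tube {O : Set Y} (hO : IsOpen O) {ψ g : Y × ℝ → ℝ}
    (hψ : ContDiffOn ℝ ∞ ψ (tube O)) (hg : ContDiffOn ℝ ∞ g (tube O))
    (hψan : ∀ y ∈ O, AnalyticOnNhd ℝ (fun r : ℝ => ψ (y, r)) univ) (hgan : ∀ y ∈ O, AnalyticOnNhd ℝ (fun r : ℝ => g (y, r)) univ)
    (hstep : ∀ k : ℕ, (∀ j ≤ (k + 1), ∀ y ∈ O, ((pd dN)^[j] ψ) (y, 0) = 0) → (∀ j ≤ (k + 1), ∀ y ∈ O, ((pd dN)^[j] g) (y, 0) = 0) →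
      (∀ j ≤ k, ∀ y ∈ O, ((pd dN)^[j] (pd dN (pd dN ψ))) (y, 0) = 0) ∧ (∀ j ≤ k, ∀ y ∈ O, ((pd dN)^[j] (pd dN (pd dN g))) (y, 0) = 0))
    (hψ0 : ∀ y ∈ O, ψ (y, 0) = 0) (hψ1 : ∀ y ∈ O, pd dN ψ (y, 0) = 0)
    (hg0 : ∀ y ∈ O, g (y, 0) = 0) (hg1 : ∀ y ∈ O, pd dN g (y, 0) = 0) :
    (∀ y ∈ O, ∀ m : ℝ, ψ (y, m) = 0) ∧ (∀ y ∈ O, ∀ m : ℝ, g (y, m) = 0) := by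
  have hall := vanishesToOrder_all_of_system hstep hψ0 hψ1 hg0 hg1
  exact ⟨fun y hy m => eq_zero_on_tube_of_vanishesToOrder hO hψ hψan (fun k => (hall k).1) hy m,
    fun y hy m => eq_zero_on_tube_of_vanishesToOrder hO hg hgan (fun k => (hall k).2) hy m⟩

end Summit.NavierStokesRegularity.NavierStokesRegularity.Theorems.PoloidalWindowDoorLrcModEntireSheetSystemUniqueness

end
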